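import Summits.QuantumFields.YangMills.Theorems.BalabanUVNodesN15FullPropagatorV1XCovAllTwoSidedNode
import HarnessLib

/-!
# ALL FOUR COVARIANT ENTRIES OF `fgFamilyV1XA` IN THE REGULARITY WINDOW: the by-parts unit `E2Unit` of the gauge-dressed pair on the torus family is DISCHARGED in the (3.35)-window
# (as FILE 32 did for the Neumann unit), and FILE 35 §3 ∕ FILE 38 §3's per-lattice identifications become window-level statements with NO unit hypothesis left
# (dag-n15-c g10, FILE 41; Track-A node N15 = NE2, s1 «background-layer OPERATOR ingredient»)

`--kind proof --supports stmt-QuantumFields-20544 --as helper` (K3⁷; count-neutral).  Imports BY NAME this seat's FILE 38 `…FullPropagatorV1XCovAllTwoSidedNode` (`fgFamilyV1XA`,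
★★★ `dressed_covDT_eq_covEntry2_torus`; through it FILE 37a `bgOpsM₂RCC` ∕ `bgFamilyM₂RCC`, FILE 36 `covEntry2` ∕ `covDT`, FILE 35 `covD_dressed_eq_covEntry1_torus` ∕ `covLapM_dressed_eq_covEntry3_torus`,
FILE 33 `covEntry1` ∕ `covEntry3`, FILE 32 ★★ `isUnit_neumann_torus_window`, FILE 30 `v1cfgFX` ∕ `v1cfgCX` ∕ ★★ `twoSidedLettersX_torus`, FILE 27 `fgInstanceV1G` ∕ ★★ `uniform_layer_fullGM₂R`,
FILE 28 `gaugeTransport` ∕ `covLapM`, FILE 3 `e2Unit_of_letters` ∕ `krowOf` ∕ `rowConst`, FILE 2 `E2Unit`, FILE 18 `hasMaj_mmulOp_translate` ∕ FILE 19 `hasMaj_mmulOp_translate_fwd`, n15-b `covD` ∕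
`opFamily`); nothing in the tree is modified.

WHY.  FILE 38 §3 identified entry 2 of the all-covariant family with `X(B)∘(D^η)ᵀ` PER LATTICE, CONDITIONAL on two displayed units: the Neumann unit `hunit` (discharged in the window by
FILE 32) and the by-parts unit `hunit2 : E2Unit (krowOf …)` of FILE 2 — so far discharged only INSIDE the engines' majorant proofs.  §1 discharges `E2Unit` in the window as a theorem
(`e2Unit_torus_window`), from the `U ≡ 1` letters of FILE 27 (`G∘∇*_ν`, the shifts `S_μ`), the coefficient rows of FILE 30's fifteen letters and FILE 3's `e2Unit_of_letters` with the
smallness `rowConst(|J|, β, c_T, a, c_r)·c_r² < 1` forced by the window `c₃₅Mα₀ ≤ a₂`.  §2 then composes: ALL THREE non-trivial entries of `fgFamilyV1XA`'s operator four-tuple are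
identified in the window with NO unit hypothesis left.

WHAT.  §1 ★★ `e2Unit_torus_window`.  §2 `bgOpsM₂RCC_one` ∕ `bgOpsM₂RCC_two` ∕ `bgOpsM₂RCC_three` (`rfl`), `fgFamilyV1XA_eq_opFamily` (the reading bridge, `rfl`), ★★★ **`covEntriesAll_torus_eq`**:
`∃ a₀ > 0, ∀ i, ∀ α₀ ∈ (0, a₀∕M], ∀ A′` regular at `(c₃₅, α₀)`: ENTRY 1 of the four-tuple at `A′` `= 𝔇(∇_{exp(η′ ad A′_ν),τ′_ν}∘X′(A′), ∇_{exp(η ad Ā_ν),τ_ν}∘X(Ā))`, ENTRY 2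
`= 𝔇(X′(A′)∘(∇_{exp(η′ ad A′_ν),τ′_ν})ᵀ, X(Ā)∘(∇_{exp(η ad Ā_ν),τ_ν})ᵀ)` (FILE 36 `covDT`, the transpose-adjoint), ENTRY 3 `= 𝔇(Δ_{exp(η′ ad A′)}∘X′(A′), Δ_{exp(η ad Ā)}∘X(Ā))`;
`Ā = gavgM π A′`, `η′ = (L^mL^k)⁻¹`, `η = (L^k)⁻¹`.  (Entry 0 is `𝔇(X′(A′), X(Ā))` by definition.)

HONEST FRAMING.  One new estimate-free fact (§1 is a smallness bookkeeping of existing letters, the mechanism of [B9] (3.64)); model-level items exactly as FILES 35∕38 (flat base point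
`U ≡ 1` of the dressing; `DRD*` ∕ `aQ*Q` at `U ≡ 1`; C² reading of (3.35)–(3.36) in one global gauge; `𝔤 ↦ 𝔄` with coordinates; linearised block-mean transport).  NE2⁺ as printed NOT
PRINTED; count-neutral; N15 NOT discharged; one finite torus at fixed ε — NOT ℝ⁴, NOT infinite volume, NOT OS, NOT a mass gap, NOT Clay.
-/

noncomputable section

open scoped BigOperators
open Finset

namespace Summit.QuantumFields.YangMills.BalabanUVNodes.N15.BackgroundLayer

open Literature.MathematicalPhysics.QuantumFieldTheory.Balaban1983to89
open Literature.MathematicalPhysics.QuantumFieldTheory.Balaban1983to89.B11SectG (BlockNorm HasMaj RowSum)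
open Literature.MathematicalPhysics.QuantumFieldTheory.Balaban1983to89.T4EtaRateDefect (idef idef_apply)
open Literature.MathematicalPhysics.QuantumFieldTheory.Balaban1983to89.T4EtaRateCoeffDefect (pull pull_apply diagK diagK_nonneg)
open Literature.MathematicalPhysics.QuantumFieldTheory.Balaban1983to89.B5Prop11Plancherel (Tor fine)
open Literature.MathematicalPhysics.QuantumFieldTheory.Balaban1983to89.B6UnitTorusCarrier (unitTorusGeo triangle254_unitTorusGeo rowSum_unitTorusGeo unitTorusGeo_dist_nonneg)
open Literature.MathematicalPhysics.QuantumFieldTheory.King1986.Torus (tdistT tdistT_nonneg tdistT_self)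
open Summit.QuantumFields.YangMills.BalabanUVNodes.N15.OperatorReadout (opFamily)
open Summit.QuantumFields.YangMills.BalabanUVNodes.N15.MatrixSpecies (mmulOp liftMap liftBlk liftEquiv basisConst basisConst_nonneg covD)
open Summit.QuantumFields.YangMills.BalabanUVNodes.N15.TwoGrid (gOp symbOp sLap TGIndex TGIndex.Mn)
open Summit.QuantumFields.YangMills.BalabanUVNodes.N15.VectorPiece (blkFine kingPrV bshiftEquiv tensorId)

variable {d : ℕ} {L : ℕ} [NeZero L]

/-! ## §1 The by-parts unit `E2Unit` of the gauge-dressed pair in the (3.35)-window -/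

section Unit

variable (d) (𝔄 : Type) [NormedRing 𝔄] [NormedAlgebra ℝ 𝔄] [CompleteSpace 𝔄] (ι : Type) [Fintype ι] [DecidableEq ι] [Nonempty ι] (e : 𝔄 ≃L[ℝ] (ι → ℝ))

/-- ★★ **THE BY-PARTS UNIT IN THE WINDOW**: for odd `L ≥ 3`, `b > 0`, `c₃₅ > 0` there is `a₀ > 0` such that for every index `i`, every `α₀ > 0` with `Mα₀ ≤ a₀` and every gauge field
`A′` on the fine torus regular at `(c₃₅, α₀)`, FILE 2's unit `E2Unit (krowOf (G′∘∇′*_ν)_ν (S′_μ)_μ (M_{a′⁺_μ∘τ′_μ⁻¹})_μ (M_{a′⁻_μ∘τ′_μ})_μ)` holds for the FINE readings `a′ = (v1cfgFX A′).2`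
(`G′ = gOp ⊗ 1_ι` at spacing `(L^mL^k)⁻¹`) AND for the COARSE readings `(v1cfgCX A′).2` at the block mean (spacing `(L^k)⁻¹`) — FILE 3 `e2Unit_of_letters` fed with FILE 27's `U ≡ 1`
letters (`G∘∇*_ν ≤ βe^{−δd}`, `S_μ ≤ c_Te^{−δd}`), the coefficient rows `≤ a = κ′c₃₅Mα₀` of FILE 30 ★★ `twoSidedLettersX_torus` (via `hasMaj_mmulOp_translate(_fwd)`), [B6]'s row sum at
`σ = δ∕2`, and the smallness `rowConst(|J|, β, c_T, a, c_r)c_r² < 1` from the window `a ≤ a₂`. [cite: Balaban1985BackgroundPropagators, (3.64) p.402 (mechanism «I − V′(A)G′ invertible for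
α₀ small»); (3.35) p.396 (the window)] -/
theorem e2Unit_torus_window (hLodd : Odd L) (hL2 : 2 ≤ L) (hL : Odd L ∧ 1 < L) {b : ℝ} (hb : 0 < b) {c35 : ℝ} (hc35 : 0 < c35) :
    ∃ a₀ : ℝ, 0 < a₀ ∧ ∀ (i : TGIndex × Fin (d + 1)) (α₀ : ℝ), 0 < α₀ → (unitTorusGeo L i.1.k (TGIndex.Mn d hL i.1)).M * α₀ ≤ a₀ →
      ∀ A' : Fin (d + 1) → Tor (fine (L ^ i.1.m * L ^ i.1.k) (TGIndex.Mn d hL i.1)) × Fin (d + 1) → 𝔄,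
        (v1GaugeBg 𝔄 (Fin (d + 1)) (fun μ => bshiftEquiv (TGIndex.Mn d hL i.1) (L ^ i.1.m * L ^ i.1.k) μ) ((unitTorusGeo L i.1.k (TGIndex.Mn d hL i.1)).eta * ((unitTorusGeo L i.1.k (TGIndex.Mn d hL i.1)).L ^ i.1.m)⁻¹) (unitTorusGeo L i.1.k (TGIndex.Mn d hL i.1)).M).Reg335 c35 α₀ A' →
        E2Unit (krowOf (fun ν => (tensorId ι (gOp (TGIndex.Mn d hL i.1) (L ^ i.1.m * L ^ i.1.k) b)) ∘ₗ fgradAdj ((L ^ i.1.m * L ^ i.1.k : ℕ) : ℝ) (liftEquiv (bshiftEquiv (TGIndex.Mn d hL i.1) (L ^ i.1.m * L ^ i.1.k) ν) ι)) (fun μ => pull (liftEquiv (bshiftEquiv (TGIndex.Mn d hL i.1) (L ^ i.1.m * L ^ i.1.k) μ) ι))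
          (fun μ => mmulOp ((v1cfgFX 𝔄 ι e (fun μ => bshiftEquiv (TGIndex.Mn d hL i.1) (L ^ i.1.m * L ^ i.1.k) μ) ((unitTorusGeo L i.1.k (TGIndex.Mn d hL i.1)).eta * ((unitTorusGeo L i.1.k (TGIndex.Mn d hL i.1)).L ^ i.1.m)⁻¹) A').2 (Sum.inl μ) ∘ ⇑(bshiftEquiv (TGIndex.Mn d hL i.1) (L ^ i.1.m * L ^ i.1.k) μ).symm)) (fun μ => mmulOp ((v1cfgFX 𝔄 ι e (fun μ => bshiftEquiv (TGIndex.Mn d hL i.1) (L ^ i.1.m * L ^ i.1.k) μ) ((unitTorusGeo L i.1.k (TGIndex.Mn d hL i.1)).eta * ((unitTorusGeo L i.1.k (TGIndex.Mn d hL i.1)).L ^ i.1.m)⁻¹) A').2 (Sum.inr μ) ∘ ⇑(bshiftEquiv (TGIndex.Mn d hL i.1) (L ^ i.1.m * L ^ i.1.k) μ)))) ∧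
        E2Unit (krowOf (fun ν => (tensorId ι (gOp (TGIndex.Mn d hL i.1) (L ^ i.1.k) b)) ∘ₗ fgradAdj ((L ^ i.1.k : ℕ) : ℝ) (liftEquiv (bshiftEquiv (TGIndex.Mn d hL i.1) (L ^ i.1.k) ν) ι)) (fun μ => pull (liftEquiv (bshiftEquiv (TGIndex.Mn d hL i.1) (L ^ i.1.k) μ) ι))
          (fun μ => mmulOp ((v1cfgCX 𝔄 ι e (kingPrV L i.1.k i.1.m (TGIndex.Mn d hL i.1)) (fun μ => bshiftEquiv (TGIndex.Mn d hL i.1) (L ^ i.1.k) μ) (unitTorusGeo L i.1.k (TGIndex.Mn d hL i.1)).eta A').2 (Sum.inl μ) ∘ ⇑(bshiftEquiv (TGIndex.Mn d hL i.1) (L ^ i.1.k) μ).symm)) (fun μ => mmulOp ((v1cfgCX 𝔄 ι e (kingPrV L i.1.k i.1.m (TGIndex.Mn d hL i.1)) (fun μ => bshiftEquiv (TGIndex.Mn d hL i.1) (L ^ i.1.k) μ) (unitTorusGeo L i.1.k (TGIndex.Mn d hL i.1)).eta A').2 (Sum.inr μ) ∘ ⇑(bshiftEquiv (TGIndex.Mn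 d hL i.1) (L ^ i.1.k) μ)))) := by
  have hγ0 : (0 : ℝ) < 1 / 16 := by norm_num
  obtain ⟨δ, β, m₀, cT, mT, hδ, -, hβ, -, -, hcT, -, H⟩ := uniform_layer_fullGM₂R d ι hLodd hL2 hL hb hγ0 le_rfl one_pos le_rfl
  have hγle1 : (1 : ℝ) / 16 ≤ 1 := by norm_num
  -- the letter scale and the window of FILE 30
  set κ' : ℝ := 14 * Real.exp 1 * (1 + Fintype.card (Fin (d + 1))) * ((1 + Fintype.card (Fin (d + 1))) * (3 + 2 * ((d : ℝ) + 1))) * (basisConst e + 1) with hκ'def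
  set r₀ : ℝ := (2 * ((1 + Fintype.card (Fin (d + 1))) * (3 + 2 * ((d : ℝ) + 1))))⁻¹ with hr₀def
  have hκe := basisConst_nonneg e
  have hdJ0 : (0 : ℝ) ≤ Fintype.card (Fin (d + 1)) := Nat.cast_nonneg _
  have hκ'pos : 0 < κ' := by positivity
  have hr₀ : 0 < r₀ := by positivity
  -- [B6]'s row-sum constant at `σ = δ/2` and the by-parts smallness window
  have hσ : 0 < δ / 2 := half_pos hδ
  set cr : ℝ := B4Sect5Proof.latticeConst (d + 1) (δ / 2) with hcrdef
  have hcr : 0 ≤ cr := B4Sect5Proof.latticeConst_nonneg (d + 1) hσ.le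
  set Q : ℝ := (cT + 1) * (Fintype.card (Fin (d + 1)) * β) * cr * cr * cr * κ' with hQdef
  have hQ : 0 ≤ Q := by positivity
  set a₂ : ℝ := (2 * (Q + 1))⁻¹ with ha₂def
  have hden : 0 < 2 * (Q + 1) := by positivity
  have ha₂ : 0 < a₂ := inv_pos.2 hden
  refine ⟨min r₀ a₂ / c35, div_pos (lt_min hr₀ ha₂) hc35, fun i α₀ hα₀ hMa A' hreg => ?_⟩
  have hMeq : (unitTorusGeo L i.1.k (TGIndex.Mn d hL i.1)).M = 1 := rfl
  have hM : (1 : ℝ) ≤ (unitTorusGeo L i.1.k (TGIndex.Mn d hL i.1)).M := by rw [hMeq]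
  have ha : c35 * (unitTorusGeo L i.1.k (TGIndex.Mn d hL i.1)).M * α₀ ≤ min r₀ a₂ := by
    rw [mul_assoc]; exact (mul_le_mul_of_nonneg_left hMa hc35.le).trans (le_of_eq (mul_div_cancel₀ _ hc35.ne'))
  have hwin : c35 * (unitTorusGeo L i.1.k (TGIndex.Mn d hL i.1)).M * α₀ ≤ r₀ := ha.trans (min_le_left _ _)
  have hwin₂ : c35 * (unitTorusGeo L i.1.k (TGIndex.Mn d hL i.1)).M * α₀ ≤ a₂ := ha.trans (min_le_right _ _)
  have ha0 : 0 ≤ κ' * (c35 * (unitTorusGeo L i.1.k (TGIndex.Mn d hL i.1)).M * α₀) := by rw [hMeq]; positivity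
  obtain ⟨-, hAc, -, hAf, -⟩ := twoSidedLettersX_torus d 𝔄 ι e hL hL2 hγle1 hc35 i A' α₀ hreg hα₀ hM hwin
  -- smallness `rowConst · c_r² < 1`
  have hq : 1 * rowConst (Fintype.card (Fin (d + 1))) β cT (κ' * (c35 * (unitTorusGeo L i.1.k (TGIndex.Mn d hL i.1)).M * α₀)) cr * cr * cr < 1 := by
    have h1 : 1 * rowConst (Fintype.card (Fin (d + 1))) β cT (κ' * (c35 * (unitTorusGeo L i.1.k (TGIndex.Mn d hL i.1)).M * α₀)) cr * cr * cr = Q * (c35 * (unitTorusGeo L i.1.k (TGIndex.Mn d hL i.1)).M * α₀) := by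
      simp only [rowConst, hQdef]; ring
    rw [h1]
    have h2 : Q * (c35 * (unitTorusGeo L i.1.k (TGIndex.Mn d hL i.1)).M * α₀) ≤ Q * a₂ := mul_le_mul_of_nonneg_left hwin₂ hQ
    refine lt_of_le_of_lt h2 ?_
    rw [ha₂def, ← div_eq_mul_inv, div_lt_one hden]
    nlinarith
  obtain ⟨-, -, -, -, -, -, -, -, hS, hS', hSh, hSh', -⟩ := H i
  have hd := fun a c : (unitTorusGeo L i.1.k (TGIndex.Mn d hL i.1)).Site => tdistT_nonneg (TGIndex.Mn d hL i.1) a c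
  have hd0 := fun a : (unitTorusGeo L i.1.k (TGIndex.Mn d hL i.1)).Site => tdistT_self (TGIndex.Mn d hL i.1) a
  have hrow := rowSum_unitTorusGeo L i.1.k (TGIndex.Mn d hL i.1) hσ
  have htri := triangle254_unitTorusGeo (L := L) (k := i.1.k) (M := (TGIndex.Mn d hL i.1))
  have hσδ : 2 * (δ / 2) ≤ δ := by linarith
  -- coefficient letters (forward translated along `e⁻¹`, backward along `e`), fine and coarse
  have hCa' : ∀ μ, HasMaj (BlockNorm.ofBlocks (unitTorusGeo L i.1.k (TGIndex.Mn d hL i.1)) (liftBlk ((blkFine L i.1.k (TGIndex.Mn d hL i.1)) ∘ (kingPrV L i.1.k i.1.m (TGIndex.Mn d hL i.1))) ι)) (BlockNorm.ofBlocks (unitTorusGeo L i.1.k (TGIndex.Mn d hL i.1)) (liftBlk ((blkFine L i.1.k (TGIndex.Mn d hL i.1)) ∘ (kingPrV L i.1.k i.1.m (TGIndex.Mn d hL i.1))) ι))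
      (mmulOp ((v1cfgFX 𝔄 ι e (fun μ => bshiftEquiv (TGIndex.Mn d hL i.1) (L ^ i.1.m * L ^ i.1.k) μ) ((unitTorusGeo L i.1.k (TGIndex.Mn d hL i.1)).eta * ((unitTorusGeo L i.1.k (TGIndex.Mn d hL i.1)).L ^ i.1.m)⁻¹) A').2 (Sum.inl μ) ∘ ⇑(bshiftEquiv (TGIndex.Mn d hL i.1) (L ^ i.1.m * L ^ i.1.k) μ).symm)) (diagK fun _ => κ' * (c35 * (unitTorusGeo L i.1.k (TGIndex.Mn d hL i.1)).M * α₀)) :=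
    fun μ => hasMaj_mmulOp_translate (g := (unitTorusGeo L i.1.k (TGIndex.Mn d hL i.1))) ((blkFine L i.1.k (TGIndex.Mn d hL i.1)) ∘ (kingPrV L i.1.k i.1.m (TGIndex.Mn d hL i.1))) (τ := fun μ => bshiftEquiv (TGIndex.Mn d hL i.1) (L ^ i.1.m * L ^ i.1.k) μ) (A := fun μ => (v1cfgFX 𝔄 ι e (fun μ => bshiftEquiv (TGIndex.Mn d hL i.1) (L ^ i.1.m * L ^ i.1.k) μ) ((unitTorusGeo L i.1.k (TGIndex.Mn d hL i.1)).eta * ((unitTorusGeo L i.1.k (TGIndex.Mn d hL i.1)).L ^ i.1.m)⁻¹) A').2 (Sum.inl μ)) ha0 (fun μ => hAf (Sum.inl μ)) μ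
  have hCb' : ∀ μ, HasMaj (BlockNorm.ofBlocks (unitTorusGeo L i.1.k (TGIndex.Mn d hL i.1)) (liftBlk ((blkFine L i.1.k (TGIndex.Mn d hL i.1)) ∘ (kingPrV L i.1.k i.1.m (TGIndex.Mn d hL i.1))) ι)) (BlockNorm.ofBlocks (unitTorusGeo L i.1.k (TGIndex.Mn d hL i.1)) (liftBlk ((blkFine L i.1.k (TGIndex.Mn d hL i.1)) ∘ (kingPrV L i.1.k i.1.m (TGIndex.Mn d hL i.1))) ι))
      (mmulOp ((v1cfgFX 𝔄 ι e (fun μ => bshiftEquiv (TGIndex.Mn d hL i.1) (L ^ i.1.m * L ^ i.1.k) μ) ((unitTorusGeo L i.1.k (TGIndex.Mn d hL i.1)).eta * ((unitTorusGeo L i.1.k (TGIndex.Mn d hL i.1)).L ^ i.1.m)⁻¹) A').2 (Sum.inr μ) ∘ ⇑(bshiftEquiv (TGIndex.Mn d hL i.1) (L ^ i.1.m * L ^ i.1.k) μ))) (diagK fun _ => κ' * (c35 * (unitTorusGeo L i.1.k (TGIndex.Mn d hL i.1)).M * α₀)) :=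
    fun μ => hasMaj_mmulOp_translate_fwd (g := (unitTorusGeo L i.1.k (TGIndex.Mn d hL i.1))) ((blkFine L i.1.k (TGIndex.Mn d hL i.1)) ∘ (kingPrV L i.1.k i.1.m (TGIndex.Mn d hL i.1))) (τ := fun μ => bshiftEquiv (TGIndex.Mn d hL i.1) (L ^ i.1.m * L ^ i.1.k) μ) (B := fun μ => (v1cfgFX 𝔄 ι e (fun μ => bshiftEquiv (TGIndex.Mn d hL i.1) (L ^ i.1.m * L ^ i.1.k) μ) ((unitTorusGeo L i.1.k (TGIndex.Mn d hL i.1)).eta * ((unitTorusGeo L i.1.k (TGIndex.Mn d hL i.1)).L ^ i.1.m)⁻¹) A').2 (Sum.inr μ)) ha0 (fun μ => hAf (Sum.inr μ)) μ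
  have hCa : ∀ μ, HasMaj (BlockNorm.ofBlocks (unitTorusGeo L i.1.k (TGIndex.Mn d hL i.1)) (liftBlk (blkFine L i.1.k (TGIndex.Mn d hL i.1)) ι)) (BlockNorm.ofBlocks (unitTorusGeo L i.1.k (TGIndex.Mn d hL i.1)) (liftBlk (blkFine L i.1.k (TGIndex.Mn d hL i.1)) ι))
      (mmulOp ((v1cfgCX 𝔄 ι e (kingPrV L i.1.k i.1.m (TGIndex.Mn d hL i.1)) (fun μ => bshiftEquiv (TGIndex.Mn d hL i.1) (L ^ i.1.k) μ) (unitTorusGeo L i.1.k (TGIndex.Mn d hL i.1)).eta A').2 (Sum.inl μ) ∘ ⇑(bshiftEquiv (TGIndex.Mn d hL i.1) (L ^ i.1.k) μ).symm)) (diagK fun _ => κ' * (c35 * (unitTorusGeo L i.1.k (TGIndex.Mn d hL i.1)).M * α₀)) :=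
    fun μ => hasMaj_mmulOp_translate (g := (unitTorusGeo L i.1.k (TGIndex.Mn d hL i.1))) (blkFine L i.1.k (TGIndex.Mn d hL i.1)) (τ := fun μ => bshiftEquiv (TGIndex.Mn d hL i.1) (L ^ i.1.k) μ) (A := fun μ => (v1cfgCX 𝔄 ι e (kingPrV L i.1.k i.1.m (TGIndex.Mn d hL i.1)) (fun μ => bshiftEquiv (TGIndex.Mn d hL i.1) (L ^ i.1.k) μ) (unitTorusGeo L i.1.k (TGIndex.Mn d hL i.1)).eta A').2 (Sum.inl μ)) ha0 (fun μ => hAc (Sum.inl μ)) μ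
  have hCb : ∀ μ, HasMaj (BlockNorm.ofBlocks (unitTorusGeo L i.1.k (TGIndex.Mn d hL i.1)) (liftBlk (blkFine L i.1.k (TGIndex.Mn d hL i.1)) ι)) (BlockNorm.ofBlocks (unitTorusGeo L i.1.k (TGIndex.Mn d hL i.1)) (liftBlk (blkFine L i.1.k (TGIndex.Mn d hL i.1)) ι))
      (mmulOp ((v1cfgCX 𝔄 ι e (kingPrV L i.1.k i.1.m (TGIndex.Mn d hL i.1)) (fun μ => bshiftEquiv (TGIndex.Mn d hL i.1) (L ^ i.1.k) μ) (unitTorusGeo L i.1.k (TGIndex.Mn d hL i.1)).eta A').2 (Sum.inr μ) ∘ ⇑(bshiftEquiv (TGIndex.Mn d hL i.1) (L ^ i.1.k) μ))) (diagK fun _ => κ' * (c35 * (unitTorusGeo L i.1.k (TGIndex.Mn d hL i.1)).M * α₀)) :=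
    fun μ => hasMaj_mmulOp_translate_fwd (g := (unitTorusGeo L i.1.k (TGIndex.Mn d hL i.1))) (blkFine L i.1.k (TGIndex.Mn d hL i.1)) (τ := fun μ => bshiftEquiv (TGIndex.Mn d hL i.1) (L ^ i.1.k) μ) (B := fun μ => (v1cfgCX 𝔄 ι e (kingPrV L i.1.k i.1.m (TGIndex.Mn d hL i.1)) (fun μ => bshiftEquiv (TGIndex.Mn d hL i.1) (L ^ i.1.k) μ) (unitTorusGeo L i.1.k (TGIndex.Mn d hL i.1)).eta A').2 (Sum.inr μ)) ha0 (fun μ => hAc (Sum.inr μ)) μ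
  exact ⟨e2Unit_of_letters (liftBlk ((blkFine L i.1.k (TGIndex.Mn d hL i.1)) ∘ (kingPrV L i.1.k i.1.m (TGIndex.Mn d hL i.1))) ι) htri hd hd0 hrow hσ.le hcr hσδ hβ.le hcT.le ha0 hS' hSh' hCa' hCb' hq,
    e2Unit_of_letters (liftBlk (blkFine L i.1.k (TGIndex.Mn d hL i.1)) ι) htri hd hd0 hrow hσ.le hcr hσδ hβ.le hcT.le ha0 hS hSh hCa hCb hq⟩

end Unit

/-! ## §2 The reading bridge and the window-level identification of entries 1, 2, 3 of the all-covariant family -/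

section Window

variable (d) (𝔄 : Type) [NormedRing 𝔄] [NormedAlgebra ℝ 𝔄] [CompleteSpace 𝔄] (ι : Type) [Fintype ι] [DecidableEq ι] [Nonempty ι] (e : 𝔄 ≃L[ℝ] (ι → ℝ))

omit [NeZero L] [CompleteSpace 𝔄] [Nonempty ι] in
/-- Entry `1` of FILE 37a's all-covariant operator four-tuple (unfolding, `rfl`). [bookkeeping] -/
theorem bgOpsM₂RCC_one {X X' J Cfg : Type} [Fintype X] [Fintype X'] [DecidableEq X] [DecidableEq X'] [Fintype J] [DecidableEq J]
    (cfgF : Cfg → (X' → Matrix ι ι ℝ) × (J ⊕ J → X' → Matrix ι ι ℝ)) (cfgC : Cfg → (X → Matrix ι ι ℝ) × (J ⊕ J → X → Matrix ι ι ℝ)) (π : X' → X)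
    (τ : J → X ≃ X) (τ' : J → X' ≃ X') (n n' : ℝ) (ν : J) (G D₃ : (X × ι → ℝ) →ₗ[ℝ] (X × ι → ℝ)) (D : J ⊕ J → (X × ι → ℝ) →ₗ[ℝ] (X × ι → ℝ))
    (G' D₃' : (X' × ι → ℝ) →ₗ[ℝ] (X' × ι → ℝ)) (D' : J ⊕ J → (X' × ι → ℝ) →ₗ[ℝ] (X' × ι → ℝ)) (U : Cfg) :
    bgOpsM₂RCC J ι cfgF cfgC π τ τ' n n' ν G D₃ D G' D₃' D' 1 U =
      idef (pull (liftMap π ι)) (pull (liftMap π ι)) (covEntry1 n'⁻¹ G' D' (cfgF U).1 (cfgF U).2 ν) (covEntry1 n⁻¹ G D (cfgC U).1 (cfgC U).2 ν) := rfl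

omit [NeZero L] [CompleteSpace 𝔄] [Nonempty ι] in
/-- Entry `2` of FILE 37a's all-covariant operator four-tuple (unfolding, `rfl`). [bookkeeping] -/
theorem bgOpsM₂RCC_two {X X' J Cfg : Type} [Fintype X] [Fintype X'] [DecidableEq X] [DecidableEq X'] [Fintype J] [DecidableEq J]
    (cfgF : Cfg → (X' → Matrix ι ι ℝ) × (J ⊕ J → X' → Matrix ι ι ℝ)) (cfgC : Cfg → (X → Matrix ι ι ℝ) × (J ⊕ J → X → Matrix ι ι ℝ)) (π : X' → X)
    (τ : J → X ≃ X) (τ' : J → X' ≃ X') (n n' : ℝ) (ν : J) (G D₃ : (X × ι → ℝ) →ₗ[ℝ] (X × ι → ℝ)) (D : J ⊕ J → (X × ι → ℝ) →ₗ[ℝ] (X × ι → ℝ))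
    (G' D₃' : (X' × ι → ℝ) →ₗ[ℝ] (X' × ι → ℝ)) (D' : J ⊕ J → (X' × ι → ℝ) →ₗ[ℝ] (X' × ι → ℝ)) (U : Cfg) :
    bgOpsM₂RCC J ι cfgF cfgC π τ τ' n n' ν G D₃ D G' D₃' D' 2 U =
      idef (pull (liftMap π ι)) (pull (liftMap π ι)) (covEntry2 τ' n'⁻¹ n' G' D' (cfgF U).1 (cfgF U).2 ν) (covEntry2 τ n⁻¹ n G D (cfgC U).1 (cfgC U).2 ν) := rfl

omit [NeZero L] [CompleteSpace 𝔄] [Nonempty ι] in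
/-- Entry `3` of FILE 37a's all-covariant operator four-tuple (unfolding, `rfl`). [bookkeeping] -/
theorem bgOpsM₂RCC_three {X X' J Cfg : Type} [Fintype X] [Fintype X'] [DecidableEq X] [DecidableEq X'] [Fintype J] [DecidableEq J]
    (cfgF : Cfg → (X' → Matrix ι ι ℝ) × (J ⊕ J → X' → Matrix ι ι ℝ)) (cfgC : Cfg → (X → Matrix ι ι ℝ) × (J ⊕ J → X → Matrix ι ι ℝ)) (π : X' → X)
    (τ : J → X ≃ X) (τ' : J → X' ≃ X') (n n' : ℝ) (ν : J) (G D₃ : (X × ι → ℝ) →ₗ[ℝ] (X × ι → ℝ)) (D : J ⊕ J → (X × ι → ℝ) →ₗ[ℝ] (X × ι → ℝ))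
    (G' D₃' : (X' × ι → ℝ) →ₗ[ℝ] (X' × ι → ℝ)) (D' : J ⊕ J → (X' × ι → ℝ) →ₗ[ℝ] (X' × ι → ℝ)) (U : Cfg) :
    bgOpsM₂RCC J ι cfgF cfgC π τ τ' n n' ν G D₃ D G' D₃' D' 3 U =
      idef (pull (liftMap π ι)) (pull (liftMap π ι)) (covEntry3 G' D₃' D' (cfgF U).1 (cfgF U).2) (covEntry3 G D₃ D (cfgC U).1 (cfgC U).2) := rfl

omit [CompleteSpace 𝔄] [Nonempty ι] in
/-- **THE READING BRIDGE**: `fgFamilyV1XA … i` IS n15-b's kernel readout `opFamily` of FILE 37a's all-covariant operator four-tuple at the exact readings, pieces and spacings of the index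
(unfolding FILE 37a `bgFamilyM₂RCC`, `rfl`). [bookkeeping] -/
theorem fgFamilyV1XA_eq_opFamily (hL : Odd L ∧ 1 < L) (b : ℝ) (i : TGIndex × Fin (d + 1)) :
    fgFamilyV1XA d 𝔄 ι e hL b i =
      opFamily (g := (unitTorusGeo L i.1.k (TGIndex.Mn d hL i.1))) (B := (fgInstanceV1G d 𝔄 ι hL i).Bf) (liftBlk (blkFine L i.1.k (TGIndex.Mn d hL i.1)) ι) (liftBlk ((blkFine L i.1.k (TGIndex.Mn d hL i.1)) ∘ (kingPrV L i.1.k i.1.m (TGIndex.Mn d hL i.1))) ι)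
        (bgOpsM₂RCC (Fin (d + 1)) ι (v1cfgFX 𝔄 ι e (fun μ => bshiftEquiv (TGIndex.Mn d hL i.1) (L ^ i.1.m * L ^ i.1.k) μ) ((unitTorusGeo L i.1.k (TGIndex.Mn d hL i.1)).eta * ((unitTorusGeo L i.1.k (TGIndex.Mn d hL i.1)).L ^ i.1.m)⁻¹)) (v1cfgCX 𝔄 ι e (kingPrV L i.1.k i.1.m (TGIndex.Mn d hL i.1)) (fun μ => bshiftEquiv (TGIndex.Mn d hL i.1) (L ^ i.1.k) μ) (unitTorusGeo L i.1.k (TGIndex.Mn d hL i.1)).eta) (kingPrV L i.1.k i.1.m (TGIndex.Mn d hL i.1)) (fun μ => bshiftEquiv (TGIndex.Mn d hL i.1) (L ^ i.1.k) μ) (fun μ => bshiftEquiv (TGIndex.Mn d hL i.1) (L ^ i.1.m * L ^ i.1.k) μ) ((L ^ i.1.k : ℕ) : ℝ) ((L ^ i.1.m * L ^ i.1.k : ℕ) : ℝ) i.2 (tensorId ι (gOp (TGIndex.Mn d hL i.1) (L ^ i.1.k) b)) (tensorId ι (symbOp (TGIndex.Mn d hL i.1) (L ^ i.1.k) (sLap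 (TGIndex.Mn d hL i.1) (L ^ i.1.k) ((L ^ i.1.k : ℕ) : ℝ)) ∘ₗ gOp (TGIndex.Mn d hL i.1) (L ^ i.1.k) b)) (dPiecesM₂ d ι (TGIndex.Mn d hL i.1) (L ^ i.1.k) b) (tensorId ι (gOp (TGIndex.Mn d hL i.1) (L ^ i.1.m * L ^ i.1.k) b)) (tensorId ι (symbOp (TGIndex.Mn d hL i.1) (L ^ i.1.m * L ^ i.1.k) (sLap (TGIndex.Mn d hL i.1) (L ^ i.1.m * L ^ i.1.k) ((L ^ i.1.m * L ^ i.1.k : ℕ) : ℝ)) ∘ₗ gOp (TGIndex.Mn d hL i.1) (L ^ i.1.m * L ^ i.1.k) b)) (dPiecesM₂ d ι (TGIndex.Mn d hL i.1) (L ^ i.1.m * L ^ i.1.k) b)) := rfl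

/-- ★★★ **ALL THREE NON-TRIVIAL COVARIANT ENTRIES IN THE WINDOW, NO UNIT HYPOTHESIS LEFT**: for odd `L ≥ 3`, `b > 0`, `c₃₅ > 0` there is `a₀ > 0` such that for EVERY index `i = ((m_T, k, m), ν)`,
every `α₀ > 0` with `Mα₀ ≤ a₀` and every gauge field `A′` on the fine torus regular at `(c₃₅, α₀)`: in the operator four-tuple behind `fgFamilyV1XA … i` (`fgFamilyV1XA_eq_opFamily`) at `A′`,
ENTRY 1 `= 𝔇(∇_{exp(η′ ad A′_ν),τ′_ν} ∘ X′(A′), ∇_{exp(η ad Ā_ν),τ_ν} ∘ X(Ā))` (n15-b `covD`), ENTRY 2 `= 𝔇(X′(A′) ∘ (∇_{exp(η′ ad A′_ν),τ′_ν})ᵀ, X(Ā) ∘ (∇_{exp(η ad Ā_ν),τ_ν})ᵀ)` (FILE 36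
`covDT`), ENTRY 3 `= 𝔇(Δ_{exp(η′ ad A′)} ∘ X′(A′), Δ_{exp(η ad Ā)} ∘ X(Ā))` (FILE 28 `covLapM`); `Ā = gavgM π A′`, `η′ = ((L^mL^k : ℕ) : ℝ)⁻¹`, `η = ((L^k : ℕ) : ℝ)⁻¹`.  Proof: FILE 35 §3
and FILE 38 §3 per lattice, the Neumann units from FILE 32 ★★ `isUnit_neumann_torus_window`, the by-parts units from §1, `a₀ = min` of the two windows.
[cite: Balaban1985BackgroundPropagators, Thm 3.1 (3.42) p.397 (the entries «∇_U G(U)λ», «G(U)∇*_U λ», «Δ_U G(U)λ») + (3.50)–(3.53) p.400 + (3.64) p.402 + (3.35) p.396] -/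
theorem covEntriesAll_torus_eq (hLodd : Odd L) (hL2 : 2 ≤ L) (hL : Odd L ∧ 1 < L) {b : ℝ} (hb : 0 < b) {c35 : ℝ} (hc35 : 0 < c35) :
    ∃ a₀ : ℝ, 0 < a₀ ∧ ∀ (i : TGIndex × Fin (d + 1)) (α₀ : ℝ), 0 < α₀ → (unitTorusGeo L i.1.k (TGIndex.Mn d hL i.1)).M * α₀ ≤ a₀ →
      ∀ A' : Fin (d + 1) → Tor (fine (L ^ i.1.m * L ^ i.1.k) (TGIndex.Mn d hL i.1)) × Fin (d + 1) → 𝔄,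
        (v1GaugeBg 𝔄 (Fin (d + 1)) (fun μ => bshiftEquiv (TGIndex.Mn d hL i.1) (L ^ i.1.m * L ^ i.1.k) μ) ((unitTorusGeo L i.1.k (TGIndex.Mn d hL i.1)).eta * ((unitTorusGeo L i.1.k (TGIndex.Mn d hL i.1)).L ^ i.1.m)⁻¹) (unitTorusGeo L i.1.k (TGIndex.Mn d hL i.1)).M).Reg335 c35 α₀ A' →
        bgOpsM₂RCC (Fin (d + 1)) ι (v1cfgFX 𝔄 ι e (fun μ => bshiftEquiv (TGIndex.Mn d hL i.1) (L ^ i.1.m * L ^ i.1.k) μ) ((unitTorusGeo L i.1.k (TGIndex.Mn d hL i.1)).eta * ((unitTorusGeo L i.1.k (TGIndex.Mn d hL i.1)).L ^ i.1.m)⁻¹)) (v1cfgCX 𝔄 ι e (kingPrV L i.1.k i.1.m (TGIndex.Mn d hL i.1)) (fun μ => bshiftEquiv (TGIndex.Mn d hL i.1) (L ^ i.1.k) μ) (unitTorusGeo L i.1.k (TGIndex.Mn d hL i.1)).eta) (kingPrV L i.1.k i.1.m (TGIndex.Mn d hL i.1)) (fun μ => bshiftEquiv (TGIndex.Mn d hL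 i.1) (L ^ i.1.k) μ) (fun μ => bshiftEquiv (TGIndex.Mn d hL i.1) (L ^ i.1.m * L ^ i.1.k) μ) ((L ^ i.1.k : ℕ) : ℝ) ((L ^ i.1.m * L ^ i.1.k : ℕ) : ℝ) i.2 (tensorId ι (gOp (TGIndex.Mn d hL i.1) (L ^ i.1.k) b)) (tensorId ι (symbOp (TGIndex.Mn d hL i.1) (L ^ i.1.k) (sLap (TGIndex.Mn d hL i.1) (L ^ i.1.k) ((L ^ i.1.k : ℕ) : ℝ)) ∘ₗ gOp (TGIndex.Mn d hL i.1) (L ^ i.1.k) b)) (dPiecesM₂ d ι (TGIndex.Mn d hL i.1) (L ^ i.1.k) b) (tensorId ι (gOp (TGIndex.Mn d hL i.1) (L ^ i.1.m * L ^ i.1.k) b)) (tensorId ι (symbOp (TGIndex.Mn d hL i.1) (L ^ i.1.m * L ^ i.1.k) (sLap (TGIndex.Mn d hL i.1) (L ^ i.1.m * L ^ i.1.k) ((L ^ i.1.m * L ^ i.1.k : ℕ) : ℝ)) ∘ₗ gOp (TGIndex.Mn d hL i.1) (L ^ i.1.m * L ^ i.1.k) b)) (dPiecesM₂ d ι (TGIndex.Mn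 d hL i.1) (L ^ i.1.m * L ^ i.1.k) b) 1 A' =
          idef (pull (liftMap (kingPrV L i.1.k i.1.m (TGIndex.Mn d hL i.1)) ι)) (pull (liftMap (kingPrV L i.1.k i.1.m (TGIndex.Mn d hL i.1)) ι))
            (covD (((L ^ i.1.m * L ^ i.1.k : ℕ) : ℝ))⁻¹ ((gaugeTransport e (bshiftEquiv (TGIndex.Mn d hL i.1) (L ^ i.1.m * L ^ i.1.k)) (((L ^ i.1.m * L ^ i.1.k : ℕ) : ℝ))⁻¹ A') (Sum.inl i.2)) (bshiftEquiv (TGIndex.Mn d hL i.1) (L ^ i.1.m * L ^ i.1.k) i.2) ∘ₗ (projO none ∘ₗ bgPairM (tensorId ι (gOp (TGIndex.Mn d hL i.1) (L ^ i.1.m * L ^ i.1.k) b)) (dPiecesM₂ d ι (TGIndex.Mn d hL i.1) (L ^ i.1.m * L ^ i.1.k) b) (v1coefCX e (((L ^ i.1.m * L ^ i.1.k : ℕ) : ℝ))⁻¹ (v1fieldsOfGauge 𝔄 (Fin (d + 1)) (bshiftEquiv (TGIndex.Mn d hL i.1) (L ^ i.1.m * L ^ i.1.k)) (((L ^ i.1.m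 * L ^ i.1.k : ℕ) : ℝ))⁻¹ A')) (v1coefAX e (((L ^ i.1.m * L ^ i.1.k : ℕ) : ℝ))⁻¹ (v1fieldsOfGauge 𝔄 (Fin (d + 1)) (bshiftEquiv (TGIndex.Mn d hL i.1) (L ^ i.1.m * L ^ i.1.k)) (((L ^ i.1.m * L ^ i.1.k : ℕ) : ℝ))⁻¹ A'))))
            (covD (((L ^ i.1.k : ℕ) : ℝ))⁻¹ ((gaugeTransport e (bshiftEquiv (TGIndex.Mn d hL i.1) (L ^ i.1.k)) (((L ^ i.1.k : ℕ) : ℝ))⁻¹ (gavgM 𝔄 (Fin (d + 1)) (kingPrV L i.1.k i.1.m (TGIndex.Mn d hL i.1)) A')) (Sum.inl i.2)) (bshiftEquiv (TGIndex.Mn d hL i.1) (L ^ i.1.k) i.2) ∘ₗ (projO none ∘ₗ bgPairM (tensorId ι (gOp (TGIndex.Mn d hL i.1) (L ^ i.1.k) b)) (dPiecesM₂ d ι (TGIndex.Mn d hL i.1) (L ^ i.1.k) b) (v1coefCX e (((L ^ i.1.k : ℕ) : ℝ))⁻¹ (v1fieldsOfGauge 𝔄 (Fin (d + 1)) (bshiftEquiv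 (TGIndex.Mn d hL i.1) (L ^ i.1.k)) (((L ^ i.1.k : ℕ) : ℝ))⁻¹ (gavgM 𝔄 (Fin (d + 1)) (kingPrV L i.1.k i.1.m (TGIndex.Mn d hL i.1)) A'))) (v1coefAX e (((L ^ i.1.k : ℕ) : ℝ))⁻¹ (v1fieldsOfGauge 𝔄 (Fin (d + 1)) (bshiftEquiv (TGIndex.Mn d hL i.1) (L ^ i.1.k)) (((L ^ i.1.k : ℕ) : ℝ))⁻¹ (gavgM 𝔄 (Fin (d + 1)) (kingPrV L i.1.k i.1.m (TGIndex.Mn d hL i.1)) A'))))) ∧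
        bgOpsM₂RCC (Fin (d + 1)) ι (v1cfgFX 𝔄 ι e (fun μ => bshiftEquiv (TGIndex.Mn d hL i.1) (L ^ i.1.m * L ^ i.1.k) μ) ((unitTorusGeo L i.1.k (TGIndex.Mn d hL i.1)).eta * ((unitTorusGeo L i.1.k (TGIndex.Mn d hL i.1)).L ^ i.1.m)⁻¹)) (v1cfgCX 𝔄 ι e (kingPrV L i.1.k i.1.m (TGIndex.Mn d hL i.1)) (fun μ => bshiftEquiv (TGIndex.Mn d hL i.1) (L ^ i.1.k) μ) (unitTorusGeo L i.1.k (TGIndex.Mn d hL i.1)).eta) (kingPrV L i.1.k i.1.m (TGIndex.Mn d hL i.1)) (fun μ => bshiftEquiv (TGIndex.Mn d hL i.1) (L ^ i.1.k) μ) (fun μ => bshiftEquiv (TGIndex.Mn d hL i.1) (L ^ i.1.m * L ^ i.1.k) μ) ((L ^ i.1.k : ℕ) : ℝ) ((L ^ i.1.m * L ^ i.1.k : ℕ) : ℝ) i.2 (tensorId ι (gOp (TGIndex.Mn d hL i.1) (L ^ i.1.k) b)) (tensorId ι (symbOp (TGIndex.Mn d hL i.1) (L ^ i.1.k) (sLap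 (TGIndex.Mn d hL i.1) (L ^ i.1.k) ((L ^ i.1.k : ℕ) : ℝ)) ∘ₗ gOp (TGIndex.Mn d hL i.1) (L ^ i.1.k) b)) (dPiecesM₂ d ι (TGIndex.Mn d hL i.1) (L ^ i.1.k) b) (tensorId ι (gOp (TGIndex.Mn d hL i.1) (L ^ i.1.m * L ^ i.1.k) b)) (tensorId ι (symbOp (TGIndex.Mn d hL i.1) (L ^ i.1.m * L ^ i.1.k) (sLap (TGIndex.Mn d hL i.1) (L ^ i.1.m * L ^ i.1.k) ((L ^ i.1.m * L ^ i.1.k : ℕ) : ℝ)) ∘ₗ gOp (TGIndex.Mn d hL i.1) (L ^ i.1.m * L ^ i.1.k) b)) (dPiecesM₂ d ι (TGIndex.Mn d hL i.1) (L ^ i.1.m * L ^ i.1.k) b) 2 A' =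
          idef (pull (liftMap (kingPrV L i.1.k i.1.m (TGIndex.Mn d hL i.1)) ι)) (pull (liftMap (kingPrV L i.1.k i.1.m (TGIndex.Mn d hL i.1)) ι))
            ((projO none ∘ₗ bgPairM (tensorId ι (gOp (TGIndex.Mn d hL i.1) (L ^ i.1.m * L ^ i.1.k) b)) (dPiecesM₂ d ι (TGIndex.Mn d hL i.1) (L ^ i.1.m * L ^ i.1.k) b) (v1coefCX e (((L ^ i.1.m * L ^ i.1.k : ℕ) : ℝ))⁻¹ (v1fieldsOfGauge 𝔄 (Fin (d + 1)) (bshiftEquiv (TGIndex.Mn d hL i.1) (L ^ i.1.m * L ^ i.1.k)) (((L ^ i.1.m * L ^ i.1.k : ℕ) : ℝ))⁻¹ A')) (v1coefAX e (((L ^ i.1.m * L ^ i.1.k : ℕ) : ℝ))⁻¹ (v1fieldsOfGauge 𝔄 (Fin (d + 1)) (bshiftEquiv (TGIndex.Mn d hL i.1) (L ^ i.1.m * L ^ i.1.k)) (((L ^ i.1.m * L ^ i.1.k : ℕ) : ℝ))⁻¹ A'))) ∘ₗ covDT (((L ^ i.1.m * L ^ i.1.k : ℕ) : ℝ))⁻¹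 ((gaugeTransport e (bshiftEquiv (TGIndex.Mn d hL i.1) (L ^ i.1.m * L ^ i.1.k)) (((L ^ i.1.m * L ^ i.1.k : ℕ) : ℝ))⁻¹ A') (Sum.inl i.2)) (bshiftEquiv (TGIndex.Mn d hL i.1) (L ^ i.1.m * L ^ i.1.k) i.2))
            ((projO none ∘ₗ bgPairM (tensorId ι (gOp (TGIndex.Mn d hL i.1) (L ^ i.1.k) b)) (dPiecesM₂ d ι (TGIndex.Mn d hL i.1) (L ^ i.1.k) b) (v1coefCX e (((L ^ i.1.k : ℕ) : ℝ))⁻¹ (v1fieldsOfGauge 𝔄 (Fin (d + 1)) (bshiftEquiv (TGIndex.Mn d hL i.1) (L ^ i.1.k)) (((L ^ i.1.k : ℕ) : ℝ))⁻¹ (gavgM 𝔄 (Fin (d + 1)) (kingPrV L i.1.k i.1.m (TGIndex.Mn d hL i.1)) A'))) (v1coefAX e (((L ^ i.1.k : ℕ) : ℝ))⁻¹ (v1fieldsOfGauge 𝔄 (Fin (d + 1)) (bshiftEquiv (TGIndex.Mn d hL i.1) (L ^ i.1.k)) (((L ^ i.1.k : ℕ) : ℝ))⁻¹ (gavgM 𝔄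 (Fin (d + 1)) (kingPrV L i.1.k i.1.m (TGIndex.Mn d hL i.1)) A')))) ∘ₗ covDT (((L ^ i.1.k : ℕ) : ℝ))⁻¹ ((gaugeTransport e (bshiftEquiv (TGIndex.Mn d hL i.1) (L ^ i.1.k)) (((L ^ i.1.k : ℕ) : ℝ))⁻¹ (gavgM 𝔄 (Fin (d + 1)) (kingPrV L i.1.k i.1.m (TGIndex.Mn d hL i.1)) A')) (Sum.inl i.2)) (bshiftEquiv (TGIndex.Mn d hL i.1) (L ^ i.1.k) i.2)) ∧
        bgOpsM₂RCC (Fin (d + 1)) ι (v1cfgFX 𝔄 ι e (fun μ => bshiftEquiv (TGIndex.Mn d hL i.1) (L ^ i.1.m * L ^ i.1.k) μ) ((unitTorusGeo L i.1.k (TGIndex.Mn d hL i.1)).eta * ((unitTorusGeo L i.1.k (TGIndex.Mn d hL i.1)).L ^ i.1.m)⁻¹)) (v1cfgCX 𝔄 ι e (kingPrV L i.1.k i.1.m (TGIndex.Mn d hL i.1)) (fun μ => bshiftEquiv (TGIndex.Mn d hL i.1) (L ^ i.1.k) μ) (unitTorusGeo L i.1.k (TGIndex.Mn d hL i.1)).eta)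 (kingPrV L i.1.k i.1.m (TGIndex.Mn d hL i.1)) (fun μ => bshiftEquiv (TGIndex.Mn d hL i.1) (L ^ i.1.k) μ) (fun μ => bshiftEquiv (TGIndex.Mn d hL i.1) (L ^ i.1.m * L ^ i.1.k) μ) ((L ^ i.1.k : ℕ) : ℝ) ((L ^ i.1.m * L ^ i.1.k : ℕ) : ℝ) i.2 (tensorId ι (gOp (TGIndex.Mn d hL i.1) (L ^ i.1.k) b)) (tensorId ι (symbOp (TGIndex.Mn d hL i.1) (L ^ i.1.k) (sLap (TGIndex.Mn d hL i.1) (L ^ i.1.k) ((L ^ i.1.k : ℕ) : ℝ)) ∘ₗ gOp (TGIndex.Mn d hL i.1) (L ^ i.1.k) b)) (dPiecesM₂ d ι (TGIndex.Mn d hL i.1) (L ^ i.1.k) b) (tensorId ι (gOp (TGIndex.Mn d hL i.1) (L ^ i.1.m * L ^ i.1.k) b)) (tensorId ι (symbOp (TGIndex.Mn d hL i.1) (L ^ i.1.m * L ^ i.1.k) (sLap (TGIndex.Mn d hL i.1) (L ^ i.1.m * L ^ i.1.k) ((L ^ i.1.m * L ^ i.1.k : ℕ) : ℝ)) ∘ₗ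 gOp (TGIndex.Mn d hL i.1) (L ^ i.1.m * L ^ i.1.k) b)) (dPiecesM₂ d ι (TGIndex.Mn d hL i.1) (L ^ i.1.m * L ^ i.1.k) b) 3 A' =
          idef (pull (liftMap (kingPrV L i.1.k i.1.m (TGIndex.Mn d hL i.1)) ι)) (pull (liftMap (kingPrV L i.1.k i.1.m (TGIndex.Mn d hL i.1)) ι))
            (covLapM (bshiftEquiv (TGIndex.Mn d hL i.1) (L ^ i.1.m * L ^ i.1.k)) (((L ^ i.1.m * L ^ i.1.k : ℕ) : ℝ))⁻¹ (gaugeTransport e (bshiftEquiv (TGIndex.Mn d hL i.1) (L ^ i.1.m * L ^ i.1.k)) (((L ^ i.1.m * L ^ i.1.k : ℕ) : ℝ))⁻¹ A') ∘ₗ (projO none ∘ₗ bgPairM (tensorId ι (gOp (TGIndex.Mn d hL i.1) (L ^ i.1.m * L ^ i.1.k) b)) (dPiecesM₂ d ι (TGIndex.Mn d hL i.1) (L ^ i.1.m * L ^ i.1.k) b) (v1coefCX e (((L ^ i.1.m * L ^ i.1.k : ℕ) : ℝ))⁻¹ (v1fieldsOfGauge 𝔄 (Fin (d + 1)) (bshiftEquiv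 (TGIndex.Mn d hL i.1) (L ^ i.1.m * L ^ i.1.k)) (((L ^ i.1.m * L ^ i.1.k : ℕ) : ℝ))⁻¹ A')) (v1coefAX e (((L ^ i.1.m * L ^ i.1.k : ℕ) : ℝ))⁻¹ (v1fieldsOfGauge 𝔄 (Fin (d + 1)) (bshiftEquiv (TGIndex.Mn d hL i.1) (L ^ i.1.m * L ^ i.1.k)) (((L ^ i.1.m * L ^ i.1.k : ℕ) : ℝ))⁻¹ A'))))
            (covLapM (bshiftEquiv (TGIndex.Mn d hL i.1) (L ^ i.1.k)) (((L ^ i.1.k : ℕ) : ℝ))⁻¹ (gaugeTransport e (bshiftEquiv (TGIndex.Mn d hL i.1) (L ^ i.1.k)) (((L ^ i.1.k : ℕ) : ℝ))⁻¹ (gavgM 𝔄 (Fin (d + 1)) (kingPrV L i.1.k i.1.m (TGIndex.Mn d hL i.1)) A')) ∘ₗ (projO none ∘ₗ bgPairM (tensorId ι (gOp (TGIndex.Mn d hL i.1) (L ^ i.1.k) b)) (dPiecesM₂ d ι (TGIndex.Mn d hL i.1) (L ^ i.1.k) b) (v1coefCX e (((L ^ i.1.k : ℕ) : ℝ))⁻¹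 (v1fieldsOfGauge 𝔄 (Fin (d + 1)) (bshiftEquiv (TGIndex.Mn d hL i.1) (L ^ i.1.k)) (((L ^ i.1.k : ℕ) : ℝ))⁻¹ (gavgM 𝔄 (Fin (d + 1)) (kingPrV L i.1.k i.1.m (TGIndex.Mn d hL i.1)) A'))) (v1coefAX e (((L ^ i.1.k : ℕ) : ℝ))⁻¹ (v1fieldsOfGauge 𝔄 (Fin (d + 1)) (bshiftEquiv (TGIndex.Mn d hL i.1) (L ^ i.1.k)) (((L ^ i.1.k : ℕ) : ℝ))⁻¹ (gavgM 𝔄 (Fin (d + 1)) (kingPrV L i.1.k i.1.m (TGIndex.Mn d hL i.1)) A'))))) := by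
  obtain ⟨a₁, ha₁, W₁⟩ := isUnit_neumann_torus_window d 𝔄 ι e hLodd hL2 hL hb hc35
  obtain ⟨a₂, ha₂, W₂⟩ := e2Unit_torus_window d 𝔄 ι e hLodd hL2 hL hb hc35
  refine ⟨min a₁ a₂, lt_min ha₁ ha₂, fun i α₀ hα₀ hαa A' hA => ?_⟩
  obtain ⟨hF, hC⟩ := W₁ i α₀ hα₀ (hαa.trans (min_le_left _ _)) A' hA
  obtain ⟨hF2, hC2⟩ := W₂ i α₀ hα₀ (hαa.trans (min_le_right _ _)) A' hA
  have h1 : (unitTorusGeo L i.1.k (TGIndex.Mn d hL i.1)).eta = ((L : ℝ) ^ i.1.k)⁻¹ := rfl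
  have h2 : (unitTorusGeo L i.1.k (TGIndex.Mn d hL i.1)).L = (L : ℝ) := rfl
  have hηf : (unitTorusGeo L i.1.k (TGIndex.Mn d hL i.1)).eta * ((unitTorusGeo L i.1.k (TGIndex.Mn d hL i.1)).L ^ i.1.m)⁻¹ = (((L ^ i.1.m * L ^ i.1.k : ℕ) : ℝ))⁻¹ := by
    rw [h1, h2, ← mul_inv, mul_comm]; push_cast; rfl
  have hηc : (unitTorusGeo L i.1.k (TGIndex.Mn d hL i.1)).eta = (((L ^ i.1.k : ℕ) : ℝ))⁻¹ := by rw [h1]; push_cast; rfl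
  rw [bgOpsM₂RCC_one, bgOpsM₂RCC_two, bgOpsM₂RCC_three, hηf, hηc]
  rw [hηf] at hF hF2
  rw [hηc] at hC hC2
  exact ⟨(congrArg₂ (idef _ _) (covD_dressed_eq_covEntry1_torus d ι e _ _ A' i.2 hF)
      (covD_dressed_eq_covEntry1_torus d ι e _ _ (gavgM 𝔄 (Fin (d + 1)) (kingPrV L i.1.k i.1.m (TGIndex.Mn d hL i.1)) A') i.2 hC)).symm,
    (congrArg₂ (idef _ _) (dressed_covDT_eq_covEntry2_torus d ι e _ _ A' i.2 hF hF2)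
      (dressed_covDT_eq_covEntry2_torus d ι e _ _ (gavgM 𝔄 (Fin (d + 1)) (kingPrV L i.1.k i.1.m (TGIndex.Mn d hL i.1)) A') i.2 hC hC2)).symm,
    (congrArg₂ (idef _ _) (covLapM_dressed_eq_covEntry3_torus d ι e _ _ A' hF)
      (covLapM_dressed_eq_covEntry3_torus d ι e _ _ (gavgM 𝔄 (Fin (d + 1)) (kingPrV L i.1.k i.1.m (TGIndex.Mn d hL i.1)) A') hC)).symm⟩

end Window

end Summit.QuantumFields.YangMills.BalabanUVNodes.N15.BackgroundLayer
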